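import Summits.BirchSwinnertonDyer.Rank1Residual.Additive.TameBranchOfTwistBranchOdd
import Summits.BirchSwinnertonDyer.Rank1Residual.Additive.XMultRankZeroCyclotomicPrimePrep
import Literature.NumberTheory.EllipticCurves.PAdicLFunctionMultBranchInterpolationProofs
import HarnessLib

/-!
# Class N10 / X4(M), X3♯(M), defect 2, (M) rows: the power-series dictionary — the E-normalised tame
# branch of `E = E♭ ⊗ χ_{p*}` with `E♭` MULTIPLICATIVE at `p` IS `c · L^±_p(f_{E♭}, a_p(E♭), ω^{(p−1)/2}, T)`,
# the branch of the ONE-TERM Mazur–Tate–Teitelbaum measure (sub-cell additive-p2, gen 22; the (M) twin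
# of `TameBranchOfTwistBranch[Odd].lean`, built over cc-typer-2's (M) producers)

HONEST FRAMING (cell `b2b-bsdres`, run/shared/lean/b2b/bsd-rank1-residual/, verbatim in every
file): the goal of the cell is to DELETE the COMBINATION-SHAPED residual classes of the
Birch–Swinnerton-Dyer formula for ALL analytic-rank `≤ 1` elliptic curves over `ℚ` — "full BSD
formula for every rank `≤ 1` curve in class `C`" assembled STRICTLY from published theorems — so
that the rank-`≤ 1` remainder becomes exactly the CONSTRUCTION-SHAPED classes, which are TYPED
(missing-input `Prop`s), NOT attempted. This is not "finishing BSD". Research route; labels / census /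
located gap UNCHANGED; nothing is booked. THEOREMS ONLY: no definition, no named fact.

## What

On the (M) rows (`E = E♭ ⊗ χ_{p*}`, Kodaira `I_n*`, `E♭` MULTIPLICATIVE at the odd prime `p`) the
relevant `p`-adic `L`-function of `E♭` is built on the ONE-TERM measure
`μ^±(a + pⁿℤ_p) = a_p^{−n}[a/pⁿ]^±` (`msdPlusMeasureMult` / `msdMinusMeasureMult`, MTT §I.10 (10.1)
with `ε(p) = 0`, `α = a_p(E♭) = ±1`): `L^±_p(g, a_p, ω^{(p−1)/2}, T) = padicLFunctionPlus/MinusBranchMult g a_p (p/2)`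
— the object of the (M) bricks `AdditivePotMult.isTorsion_and_exists_iota_eq_of_katoHalf` /
`…_of_wuthrichHalf`. cc-typer-2 typed and PROVED the comparison statements (`LegendreTwistPlusRel` /
`LegendreTwistMinusRel`, `exists_legendreTwist[Plus|Minus]Rel_of_twist`) and produced the tame branch
existentially (`exists_isTameBranchOf_legendre[Minus]_of_mult`, `…_of_mult_twist[_neg]`). With the
one-term branch interpolation (`Literature/…/PAdicLFunctionMultBranchInterpolationProofs.lean`, this
seat gen 22) THIS FILE names it, for both parities:

* `isTameBranchOf_legendre_C_mul_padicLFunctionPlusBranchMult` (even branch, `LegendreTwistPlusRel`):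
  for a rational newform `g` of level `N'` with `p ∣ N'`, `a_p(g) = ap = ±1`, and `f` with
  `LegendreTwistPlusRel p f g c`: **`IsTameBranchOf f p (ι∘χ_p) ap (C(c)·L⁺_p(g, ap, ω^{(p−1)/2}, T))`**;
  `…MinusBranchMult` (odd branch, `LegendreTwistMinusRel`);
* uniqueness / `↔` forms and the curve-level forms `exists_forall_isTameBranchOf_iff_of_mult_twist[_neg]`
  (`E ≅ V ⊗ χ_{±p}`, `V` multiplicative at `p`, `p ≡ 1` resp. `3 (mod 4)`; `α = a_p(V) = V.LFunction p`).

Consumer (`TameBranchKatoDivisibilityOfKatoMult.lean`): `TameBranchRatDvdAt W p` on X4(M) ∩ surj /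
X3♯(M) at every odd `p` from Kato 17.4 (3) / Wuthrich 16. What is NOT claimed: any Literature fact;
any booking. Labels UNCHANGED.

References: Mazur–Tate–Teitelbaum, Invent. Math. 84 (1986) §I.8, §I.10 (10.1), §I.13–I.14
[MazurTateTeitelbaum1986Invent]; Delbourgo, Compositio Math. 113 (1998) §1.5, hypothesis (M) p. 133
[Delbourgo1998]; cc-typer-2's `TameBranchOfSemistableTwist[Join].lean`,
`LegendreTwist[Minus]RelationOfCurveTwist.lean`; additive-p4 / n1011's `XMultRankZeroCyclotomicPrimePrep.lean`.
-/

noncomputable section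

open scoped Classical MatrixGroups ModularForm

open CongruenceSubgroup

namespace Summit.BirchSwinnertonDyer.Rank1Residual.Additive

open Literature.NumberTheory.EllipticCurves Literature.NumberTheory.EllipticCurves.ModularForms
  Literature.NumberTheory.EllipticCurves.Rank1Residual WeierstrassCurve

section Dictionary

variable {p : ℕ} [hp : Fact p.Prime] {N N' : ℕ} [NeZero N'] {f : CuspForm (Gamma0 N) 2}
  {g : CuspForm (Gamma0 N') 2}

/-- `‖ap‖_p = 1` and `ap ≠ 0` in `ℚ_p` for `ap = ±1`. [folklore] -/
theorem norm_intCast_eq_one_of_eq_one_or_eq_neg_one {ap : ℤ} (hap1 : ap = 1 ∨ ap = -1) :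
    ‖((ap : ℤ) : ℚ_[p])‖ = 1 ∧ ((ap : ℤ) : ℚ_[p]) ≠ 0 := by
  have h : ‖((ap : ℤ) : ℚ_[p])‖ = 1 := by rcases hap1 with h | h <;> simp [h]
  exact ⟨h, fun h0 ↦ by rw [h0, norm_zero] at h; exact zero_ne_one h⟩

/-- **THE DICTIONARY on (M), even branch.** Let `g` be a normalised newform of level `N'` with rational
coefficients, `p ∣ N'` (odd `p`), `a_p(g) = ap = ±1`, and let `f` satisfy the Legendre twist relation
`LegendreTwistPlusRel p f g c` (`[s]⁺_f = c·∑_u(u/p)[s+u/p]⁺_g`; a THEOREM for `f = f_E`, `g = f_{E♭}`,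
`E ≅ E♭ ⊗ χ_p`, `p ≡ 1 (mod 4)`). Then `C(c)·L⁺_p(g, ap, ω^{(p−1)/2}, T)` (`padicLFunctionPlusBranchMult`)
satisfies cc-typer-2's package `IsTameBranchOf f p (ι∘χ_p) ap`: bounded
(`norm_coeff_padicLFunctionPlusBranchMult_le`, `exists_norm_ratPlusSymbol_le`), constant term
`c·ap⁻¹∑_a(a/p)[a/p]⁺_g = ap⁻¹[0]⁺_f` (`constantCoeff_padicLFunctionPlusBranchMult_half`), value at a
primitive wild `κ` of conductor `p^m ≥ p²`: `c·ap^{−m}∑_a κ(a)(a/p)[a/p^m]⁺_g = ap^{−m}p^{−1}τ(χ_p,ψ_κ)∑_bκ(b)[b/p^m]⁺_f`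
(`hasSum_padicLPlusBranchMultCoeff_mul_pow`, `teichWeight_half_castHom_eq_legendreChar`,
`sum_mul_twistPartnerMeasure_eq` with `Φ = c·[·]⁺_g`).
[cite: MazurTateTeitelbaum1986Invent, §I.10 (10.1) with ε(p) = 0 and §I.13–I.14]
[cite: Delbourgo1998, hypothesis (M) (p. 133)] -/
theorem isTameBranchOf_legendre_C_mul_padicLFunctionPlusBranchMult (hp2 : p ≠ 2) (hg : IsNewform0 g)
    (hQ : coeffField g = ⊥) (hpN : p ∣ N') {ap : ℤ} (hap : cuspCoeff g p = ap)
    (hap1 : ap = 1 ∨ ap = -1) {c : ℚ} (hrel : LegendreTwistPlusRel p f g c) :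
    IsTameBranchOf f p ((legendreChar p).ringHomComp (algebraMap ℚ_[p] ℂ_[p])) ((ap : ℤ) : ℚ_[p])
      (PowerSeries.C (c : ℚ_[p]) * padicLFunctionPlusBranchMult g ((ap : ℤ) : ℚ_[p]) (p / 2)) := by
  haveI : NeZero p := ⟨hp.out.ne_zero⟩
  obtain ⟨hαu, hα0⟩ := norm_intCast_eq_one_of_eq_one_or_eq_neg_one (p := p) hap1
  set α : ℚ_[p] := ((ap : ℤ) : ℚ_[p]) with hα
  set ι : ℚ_[p] →+* ℂ_[p] := algebraMap ℚ_[p] ℂ_[p] with hι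
  have hdist := sum_fiber_msdPlusMeasureMult_succ_eq_of_coeffField (p := p) hg hQ hpN hap hα0
  -- boundedness of the one-term measure: `‖α⁻ⁿ[a/pⁿ]⁺‖ ≤ C`
  obtain ⟨C, hCsym⟩ := exists_norm_ratPlusSymbol_le (p := p) hg hQ
  have hC : ∀ (n : ℕ) (a : ZMod (p ^ n)), ‖msdPlusMeasureMult g α n a‖ ≤ C := fun n a ↦ by
    rw [msdPlusMeasureMult, norm_mul, norm_pow, norm_inv, hαu, inv_one, one_pow, one_mul]
    exact hCsym n a
  set Φ : ℚ → ℚ_[p] := fun r ↦ (c : ℚ_[p]) * ((ratPlusSymbol g r : ℚ) : ℚ_[p]) with hΦ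
  have hper : ∀ s, Φ (s + 1) = Φ s := fun s ↦ by
    simp only [hΦ]
    rw [show (s + 1 : ℚ) = s + ((1 : ℤ) : ℚ) by push_cast; rfl, ratPlusSymbol_add_intCast_eq]
  have hx : ∀ s, ((ratPlusSymbol f s : ℚ) : ℚ_[p]) =
      ∑ b : ZMod p, (legendreChar p)⁻¹ b * Φ (s + (b.val : ℚ) / p) := fun s ↦ hrel.cast_eq_twist s
  refine ⟨⟨‖(c : ℚ_[p])‖ * C, fun n ↦ ?_⟩, ?_, ?_⟩
  · rw [PowerSeries.coeff_C_mul, norm_mul]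
    exact mul_le_mul_of_nonneg_left (norm_coeff_padicLFunctionPlusBranchMult_le g α hdist hC _ n)
      (norm_nonneg _)
  · rw [map_mul, PowerSeries.constantCoeff_C,
      constantCoeff_padicLFunctionPlusBranchMult_half p hp2 hg hQ hpN hap hα0]
    have h0 : ratPlusSymbol f 0 = c * legendrePlusSymbolSum g p := by
      rw [hrel 0, legendrePlusSymbolSum_def]
      simp_rw [zero_add]
    rw [h0]
    push_cast
    ring
  · intro m hm κ hκ heven hordκ
    obtain ⟨m', rfl⟩ : ∃ m', m = m' + 1 := ⟨m - 1, by omega⟩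
    have he : cyclotomicExponent p ≤ m' + 1 := by rw [cyclotomicExponent_eq_one p hp2]; omega
    have h1 := hasSum_padicLPlusBranchMultCoeff_mul_pow g α hdist hC (p / 2) he κ heven hordκ
    have h2 := h1.mul_left (ι (c : ℚ_[p]))
    have hval := sum_mul_twistPartnerMeasure_eq (f := f) (ã := α) hm (legendreChar_ne_one p hp2) hper
      hx hκ
    have hv : ∑ a : ZMod (p ^ (m' + 1)), κ a * ι (twistPartnerMeasure (legendreChar p) Φ α
          ((ratPlusSymbol f 0 : ℚ) : ℚ_[p]) (m' + 1) a) =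
        ι (c : ℚ_[p]) * (ι (α⁻¹ ^ (m' + 1)) * ∑ a : ZMod (p ^ (m' + 1)), κ a *
          ι (teichWeight p (p / 2) (ZMod.castHom (pow_dvd_pow p he)
            (ZMod (p ^ cyclotomicExponent p)) a)) *
          (ratPlusSymbol g ((a.val : ℚ) / ((p ^ (m' + 1) : ℕ) : ℚ)) : ℂ_[p])) := by
      rw [Finset.mul_sum, Finset.mul_sum]
      refine Finset.sum_congr rfl fun a _ ↦ ?_
      rw [twistPartnerMeasure_succ, teichWeight_half_castHom_eq_legendreChar p hp2 he a,
        legendreChar_inv]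
      simp only [hΦ, map_mul, map_ratCast, Nat.cast_pow]
      ring
    have hfun : (fun k : ℕ ↦ ι (PowerSeries.coeff k (PowerSeries.C (c : ℚ_[p]) *
          padicLFunctionPlusBranchMult g α (p / 2))) *
            (κ (cyclotomicGenerator p : ZMod (p ^ (m' + 1))) - 1) ^ k) =
        fun k : ℕ ↦ ι (c : ℚ_[p]) * (ι (padicLPlusBranchMultCoeff g α (p / 2) k) *
          (κ (cyclotomicGenerator p : ZMod (p ^ (m' + 1))) - 1) ^ k) := by
      funext k
      rw [PowerSeries.coeff_C_mul, coeff_padicLFunctionPlusBranchMult, map_mul, mul_assoc]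
    rw [hfun, ← hval, hv]
    exact h2

/-- **THE DICTIONARY on (M), odd branch** (`LegendreTwistMinusRel`, minus symbols, one-term minus
measure): `IsTameBranchOf f p (ι∘χ_p) ap (C(c)·L⁻_p(g, ap, ω^{(p−1)/2}, T))`. Bound of `μ⁻` from
cc-typer-2's `exists_forall_norm_ratMinusSymbol_le_of_maninDrinfeld`; constant term
`constantCoeff_padicLFunctionMinusBranchMult_half`. [cite: MazurTateTeitelbaum1986Invent, §I.10 (10.1) with ε(p) = 0 and §I.13–I.14]
[cite: Delbourgo1998, hypothesis (M) (p. 133)] -/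
theorem isTameBranchOf_legendre_C_mul_padicLFunctionMinusBranchMult (hp2 : p ≠ 2) (hg : IsNewform0 g)
    (hQ : coeffField g = ⊥) (hpN : p ∣ N') {ap : ℤ} (hap : cuspCoeff g p = ap)
    (hap1 : ap = 1 ∨ ap = -1) {c : ℚ} (hrel : LegendreTwistMinusRel p f g c) :
    IsTameBranchOf f p ((legendreChar p).ringHomComp (algebraMap ℚ_[p] ℂ_[p])) ((ap : ℤ) : ℚ_[p])
      (PowerSeries.C (c : ℚ_[p]) * padicLFunctionMinusBranchMult g ((ap : ℤ) : ℚ_[p]) (p / 2)) := by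
  haveI : NeZero p := ⟨hp.out.ne_zero⟩
  obtain ⟨hαu, hα0⟩ := norm_intCast_eq_one_of_eq_one_or_eq_neg_one (p := p) hap1
  set α : ℚ_[p] := ((ap : ℤ) : ℚ_[p]) with hα
  set ι : ℚ_[p] →+* ℂ_[p] := algebraMap ℚ_[p] ℂ_[p] with hι
  have hdist := sum_fiber_msdMinusMeasureMult_succ_eq_of_coeffField (p := p) hg hQ hpN hap hα0
  obtain ⟨C, -, hCsym⟩ := exists_forall_norm_ratMinusSymbol_le_of_maninDrinfeld (p := p)
    (exists_nsmul_modularSymbol_mem_periodLattice_of_isNewform0 hg hQ)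
  have hC : ∀ (n : ℕ) (a : ZMod (p ^ n)), ‖msdMinusMeasureMult g α n a‖ ≤ C := fun n a ↦ by
    rw [msdMinusMeasureMult, norm_mul, norm_pow, norm_inv, hαu, inv_one, one_pow, one_mul]
    exact hCsym _
  set Φ : ℚ → ℚ_[p] := fun r ↦ (c : ℚ_[p]) * ((ratMinusSymbol g r : ℚ) : ℚ_[p]) with hΦ
  have hper : ∀ s, Φ (s + 1) = Φ s := fun s ↦ by
    simp only [hΦ]
    rw [show (s + 1 : ℚ) = s + ((1 : ℤ) : ℚ) by push_cast; rfl, ratMinusSymbol_add_intCast]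
  have hx : ∀ s, ((ratPlusSymbol f s : ℚ) : ℚ_[p]) =
      ∑ b : ZMod p, (legendreChar p)⁻¹ b * Φ (s + (b.val : ℚ) / p) := fun s ↦ hrel.cast_eq_twist s
  refine ⟨⟨‖(c : ℚ_[p])‖ * C, fun n ↦ ?_⟩, ?_, ?_⟩
  · rw [PowerSeries.coeff_C_mul, norm_mul]
    exact mul_le_mul_of_nonneg_left (norm_coeff_padicLFunctionMinusBranchMult_le g α hdist hC _ n)
      (norm_nonneg _)
  · rw [map_mul, PowerSeries.constantCoeff_C,
      constantCoeff_padicLFunctionMinusBranchMult_half p hp2 hg hQ hpN hap hα0]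
    have h0 : ratPlusSymbol f 0 = c * legendreMinusSymbolSum g p := by
      rw [hrel 0, legendreMinusSymbolSum_def]
      simp_rw [zero_add]
    rw [h0]
    push_cast
    ring
  · intro m hm κ hκ heven hordκ
    obtain ⟨m', rfl⟩ : ∃ m', m = m' + 1 := ⟨m - 1, by omega⟩
    have he : cyclotomicExponent p ≤ m' + 1 := by rw [cyclotomicExponent_eq_one p hp2]; omega
    have h1 := hasSum_padicLMinusBranchMultCoeff_mul_pow g α hdist hC (p / 2) he κ heven hordκ
    have h2 := h1.mul_left (ι (c : ℚ_[p]))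
    have hval := sum_mul_twistPartnerMeasure_eq (f := f) (ã := α) hm (legendreChar_ne_one p hp2) hper
      hx hκ
    have hv : ∑ a : ZMod (p ^ (m' + 1)), κ a * ι (twistPartnerMeasure (legendreChar p) Φ α
          ((ratPlusSymbol f 0 : ℚ) : ℚ_[p]) (m' + 1) a) =
        ι (c : ℚ_[p]) * (ι (α⁻¹ ^ (m' + 1)) * ∑ a : ZMod (p ^ (m' + 1)), κ a *
          ι (teichWeight p (p / 2) (ZMod.castHom (pow_dvd_pow p he)
            (ZMod (p ^ cyclotomicExponent p)) a)) *
          (ratMinusSymbol g ((a.val : ℚ) / ((p ^ (m' + 1) : ℕ) : ℚ)) : ℂ_[p])) := by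
      rw [Finset.mul_sum, Finset.mul_sum]
      refine Finset.sum_congr rfl fun a _ ↦ ?_
      rw [twistPartnerMeasure_succ, teichWeight_half_castHom_eq_legendreChar p hp2 he a,
        legendreChar_inv]
      simp only [hΦ, map_mul, map_ratCast, Nat.cast_pow]
      ring
    have hfun : (fun k : ℕ ↦ ι (PowerSeries.coeff k (PowerSeries.C (c : ℚ_[p]) *
          padicLFunctionMinusBranchMult g α (p / 2))) *
            (κ (cyclotomicGenerator p : ZMod (p ^ (m' + 1))) - 1) ^ k) =
        fun k : ℕ ↦ ι (c : ℚ_[p]) * (ι (padicLMinusBranchMultCoeff g α (p / 2) k) *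
          (κ (cyclotomicGenerator p : ZMod (p ^ (m' + 1))) - 1) ^ k) := by
      funext k
      rw [PowerSeries.coeff_C_mul, coeff_padicLFunctionMinusBranchMult, map_mul, mul_assoc]
    rw [hfun, ← hval, hv]
    exact h2

/-! ### Uniqueness and curve-level forms -/

/-- **Every E-normalised tame branch for `(f, χ_p, ap)` on an (M) row IS `C(c)·L⁺_p(g, ap, ω^{(p−1)/2}, T)`**
(even branch; `IsTameBranchOf.unique`). [cite: MazurTateTeitelbaum1986Invent, §I.11 and §I.14 (14.3)] -/
theorem IsTameBranchOf.eq_C_mul_padicLFunctionPlusBranchMult (hp2 : p ≠ 2) (hg : IsNewform0 g)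
    (hQ : coeffField g = ⊥) (hpN : p ∣ N') {ap : ℤ} (hap : cuspCoeff g p = ap)
    (hap1 : ap = 1 ∨ ap = -1) {c : ℚ} (hrel : LegendreTwistPlusRel p f g c) {B : PowerSeries ℚ_[p]}
    (hB : IsTameBranchOf f p ((legendreChar p).ringHomComp (algebraMap ℚ_[p] ℂ_[p]))
      ((ap : ℤ) : ℚ_[p]) B) :
    B = PowerSeries.C (c : ℚ_[p]) * padicLFunctionPlusBranchMult g ((ap : ℤ) : ℚ_[p]) (p / 2) :=
  hB.unique (isTameBranchOf_legendre_C_mul_padicLFunctionPlusBranchMult hp2 hg hQ hpN hap hap1 hrel)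

/-- Odd twin: every branch for `(f, χ_p, ap)` IS `C(c)·L⁻_p(g, ap, ω^{(p−1)/2}, T)`.
[cite: MazurTateTeitelbaum1986Invent, §I.11 and §I.14 (14.3)] -/
theorem IsTameBranchOf.eq_C_mul_padicLFunctionMinusBranchMult (hp2 : p ≠ 2) (hg : IsNewform0 g)
    (hQ : coeffField g = ⊥) (hpN : p ∣ N') {ap : ℤ} (hap : cuspCoeff g p = ap)
    (hap1 : ap = 1 ∨ ap = -1) {c : ℚ} (hrel : LegendreTwistMinusRel p f g c) {B : PowerSeries ℚ_[p]}
    (hB : IsTameBranchOf f p ((legendreChar p).ringHomComp (algebraMap ℚ_[p] ℂ_[p]))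
      ((ap : ℤ) : ℚ_[p]) B) :
    B = PowerSeries.C (c : ℚ_[p]) * padicLFunctionMinusBranchMult g ((ap : ℤ) : ℚ_[p]) (p / 2) :=
  hB.unique (isTameBranchOf_legendre_C_mul_padicLFunctionMinusBranchMult hp2 hg hQ hpN hap hap1 hrel)

/-- **Curve level on (M), `p ≡ 1 (mod 4)`, UNCONDITIONAL.** `E = W ≅ V ⊗ χ_p` additive at `p`, `V`
MULTIPLICATIVE at `p`, `f`, `g` the newforms of `W`, `V`: there is `c ∈ ℚ` with
`∀ B, IsTameBranchOf f p (ι∘χ_p) (a_p(V)) B ↔ B = C(c)·L⁺_p(g, a_p(V), ω^{(p−1)/2}, T)` (`a_p(V) = V.LFunction p = ±1`,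
`p ∣ N'` by cc-typer-2's `LFunction_eq_or_eq_neg_and_dvd_level_of_mult`; the comparison statement by
`exists_legendreTwistPlusRel_of_twist`). [cite: MazurTateTeitelbaum1986Invent, §I.13–I.14] [cite: Shimura1971, Prop. 3.64] -/
theorem exists_forall_isTameBranchOf_iff_of_mult_twist (hp4 : p % 4 = 1)
    (V W : WeierstrassCurve ℚ) [V.IsElliptic] [W.IsElliptic] [NeZero N]
    (hVW : ∃ C : VariableChange ℚ, C • V.quadraticTwist (p : ℚ) = W) (hadd : Addv W p)
    (hV : Mult V p) (hf : IsNewformOf W f) (hg : IsNewformOf V g) :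
    ∃ c : ℚ, ∀ B : PowerSeries ℚ_[p],
      IsTameBranchOf f p ((legendreChar p).ringHomComp (algebraMap ℚ_[p] ℂ_[p]))
          ((V.LFunction p : ℤ) : ℚ_[p]) B ↔
        B = PowerSeries.C (c : ℚ_[p]) *
          padicLFunctionPlusBranchMult g ((V.LFunction p : ℤ) : ℚ_[p]) (p / 2) := by
  have hp2 : p ≠ 2 := (ne_two_and_legendreSym_neg_one_of_mod_four_eq_one (p := p) hp4).1
  obtain ⟨c, hrel⟩ := exists_legendreTwistPlusRel_of_twist hp4 V W hVW hadd hf hg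
  obtain ⟨hap1, hpN⟩ := LFunction_eq_or_eq_neg_and_dvd_level_of_mult V hV hg
  have h := isTameBranchOf_legendre_C_mul_padicLFunctionPlusBranchMult hp2 hg.1 hg.coeffField_eq_bot
    hpN (hg.2 p) hap1 hrel
  exact ⟨c, fun B ↦ ⟨fun hB ↦ hB.unique h, fun hB ↦ hB ▸ h⟩⟩

/-- **Curve level on (M), `p ≡ 3 (mod 4)`, UNCONDITIONAL** (`E ≅ V ⊗ χ_{−p}`, odd branch):
`∃ c, ∀ B, IsTameBranchOf f p (ι∘χ_p) (a_p(V)) B ↔ B = C(c)·L⁻_p(g, a_p(V), ω^{(p−1)/2}, T)`.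
[cite: MazurTateTeitelbaum1986Invent, §I.13–I.14] [cite: Shimura1971, Prop. 3.64] -/
theorem exists_forall_isTameBranchOf_iff_of_mult_twist_neg (hp4 : p % 4 = 3)
    (V W : WeierstrassCurve ℚ) [V.IsElliptic] [W.IsElliptic] [NeZero N]
    (hVW : ∃ C : VariableChange ℚ, C • V.quadraticTwist (-(p : ℚ)) = W) (hadd : Addv W p)
    (hV : Mult V p) (hf : IsNewformOf W f) (hg : IsNewformOf V g) :
    ∃ c : ℚ, ∀ B : PowerSeries ℚ_[p],
      IsTameBranchOf f p ((legendreChar p).ringHomComp (algebraMap ℚ_[p] ℂ_[p]))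
          ((V.LFunction p : ℤ) : ℚ_[p]) B ↔
        B = PowerSeries.C (c : ℚ_[p]) *
          padicLFunctionMinusBranchMult g ((V.LFunction p : ℤ) : ℚ_[p]) (p / 2) := by
  have hp2 : p ≠ 2 := (ne_two_and_legendreSym_neg_one_of_mod_four_eq_three (p := p) hp4).1
  obtain ⟨c, hrel⟩ := exists_legendreTwistMinusRel_of_twist hp4 V W hVW hadd hf hg
  obtain ⟨hap1, hpN⟩ := LFunction_eq_or_eq_neg_and_dvd_level_of_mult V hV hg
  have h := isTameBranchOf_legendre_C_mul_padicLFunctionMinusBranchMult hp2 hg.1 hg.coeffField_eq_bot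
    hpN (hg.2 p) hap1 hrel
  exact ⟨c, fun B ↦ ⟨fun hB ↦ hB.unique h, fun hB ↦ hB ▸ h⟩⟩

end Dictionary

end Summit.BirchSwinnertonDyer.Rank1Residual.Additive

end
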